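import Literature.ModelTheory.ExponentialFields.ROMinimal
import Literature.ModelTheory.ExponentialFields.EOverRestrictedExp
import HarnessLib

/-!
# `T_e` through `T_{exp↾}`: the `e`-reducts of the models of `T_exp` under Wilkie's First Main Theorem

Topic `Literature/ModelTheory/ExponentialFields`.  den Besten 2016, Lemma 6.2.3: "the models of
`T_e` and `T_{exp↾}` have the same definable sets" — `e(x) = exp((1 + x²)⁻¹)` is existentially
definable from `exp↾[0,1]` (`y = e(x) ↔ ∃ u (u · (1 + x·x) = 1 ∧ y = exp↾(u))`, since
`(1 + x²)⁻¹ ∈ (0, 1]`) and conversely — whence (Corollary 6.2.4) the model completeness of `T_e`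
from the First Main Theorem for `T_{exp↾}` (Theorem 2.1.1).  For the `e`-reducts of the models
`k ⊆ K` of `T_exp` — the only models of `T_e` that Wilkie's §§9–11 / den Besten's chapter 7
work in — this file derives the two consequences directly from the hypothesis
`rexpTheory.IsModelComplete` (Wilkie's First Main Theorem for `exp↾[0,1]`, verbatim):

* `RealExpModel.isOMinimal_orderedERing_of_rexp_isModelComplete`: **every `K | L_e` is o-minimal**
  (den Besten, Theorem 7.2.1, o-minimality clause);
* `RealExpModel.eElementaryEmbeddingOfRexp`: **`k | L_e ≼ K | L_e`** for every embedding
  `k ↪ K` of models of `T_exp` (den Besten, p. 75), by `DefinitionalExpansion.lean`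
  (`Definitions.IsDefinedBy.elementaryEmbeddingSum`: an `L_{exp↾}`-elementary embedding is
  `L_{exp↾} ∪ {e}`-elementary, `e` being `L_{exp↾}`-definable) and the reduct to `L_e`.

Ingredients (`EOverRestrictedExp.lean`): `eOverRexpDefs` (the definition of `e` over
`L_{exp↾}`) with `RealExpModel.eOverRexpDefs_isDefinedBy`, and the inclusion
`orderedERingRexpHom : L_e → L_{exp↾} ∪ {e}`.  Nothing here is a named fact.

## References

* M. den Besten, MSc thesis, Utrecht 2016: Lemma 6.2.3, Corollary 6.2.4, Theorem 7.2.1, p. 75.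
  [DenBesten2016]
* A. J. Wilkie, J. Amer. Math. Soc. 9 (1996): First Main Theorem, Example (A) p. 1053,
  Theorem 11.1. [WilkieJAMS1996]
-/

noncomputable section

open FirstOrder FirstOrder.Language FirstOrder.Language.Structure
open scoped FirstOrder

namespace Literature.ModelTheory.ExponentialFields

universe w

namespace RealExpModel

/-- **First Main Theorem ⇒ every `K | L_e` is o-minimal** (`K ⊨ T_exp`; den Besten 2016,
Theorem 7.2.1 with Corollary 4.1.7 and Lemma 6.2.3; Wilkie 1996, Theorem 11.1), the First Main
Theorem for `exp↾[0,1]` being the hypothesis `hMC : rexpTheory.IsModelComplete`.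
[cite: DenBesten2016, Theorem 7.2.1] -/
theorem isOMinimal_orderedERing_of_rexp_isModelComplete (hMC : rexpTheory.IsModelComplete)
    (K : Language.Theory.ModelType.{0, 0, 0} realExpTheory) :
    Language.orderedERing.IsOMinimal K := fun S hS =>
  isOMinimal_orderedRexpRing_of_isModelComplete hMC K S
    (definable_orderedRexpRing_of_definable_orderedERing K hS)

/-- **First Main Theorem ⇒ `(ℝ; +, ·, -, 0, 1, e, ≤)` is o-minimal** (the standard model of `T_e`;
Wilkie 1996, Theorem 11.1). [cite: WilkieJAMS1996, Theorem 11.1] -/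
theorem _root_.Literature.ModelTheory.ExponentialFields.Real.isOMinimal_orderedERing_of_rexp_isModelComplete
    (hMC : rexpTheory.IsModelComplete) : Language.orderedERing.IsOMinimal ℝ := fun S hS =>
  Real.isOMinimal_orderedRexpRing_of_isModelComplete hMC S
    (Real.definable_orderedRexpRing_of_definable_orderedERing hS)

/-! ### `k | L_e ≼ K | L_e` from the First Main Theorem -/

/-- **First Main Theorem ⇒ `k | L_e ≼ K | L_e`**: for an embedding `f : k ↪ K` of models of
`T_exp`, `L_e`-formulas with parameters from `k` hold in `k` iff in `K` (den Besten 2016, p. 75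
and Corollary 6.2.4: `f` is `L_{exp↾}`-elementary by the First Main Theorem, hence
`L_{exp↾} ∪ {e}`-elementary as `e` is `L_{exp↾}`-definable, hence `L_e`-elementary).
[cite: DenBesten2016, Corollary 6.2.4] -/
theorem realize_orderedERing_comp_iff_of_rexp_isModelComplete
    (hMC : rexpTheory.IsModelComplete) {k K : Language.Theory.ModelType.{0, 0, 0} realExpTheory}
    (f : k ↪[Language.orderedExpRing] K) {n : ℕ} (φ : Language.orderedERing.Formula (Fin n))
    (x : Fin n → k) : φ.Realize (f ∘ x) ↔ φ.Realize x := by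
  let g : k ↪ₑ[Language.orderedRexpRing.sum Language.eUnary] K :=
    (eOverRexpDefs_isDefinedBy k).elementaryEmbeddingSum (eOverRexpDefs_isDefinedBy K)
      (rexpElementaryEmbedding hMC f)
  have hg : (g : k → K) = f := rfl
  rw [← LHom.realize_onFormula orderedERingRexpHom φ (v := f ∘ x),
    ← LHom.realize_onFormula orderedERingRexpHom φ (v := x), ← hg]
  exact g.map_formula _ x

/-- **The `e`-reduct of an embedding of models of `T_exp` as an elementary embedding of
`L_e`-structures, from the First Main Theorem for `exp↾[0,1]`.** [cite: DenBesten2016, Corollary 6.2.4] -/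
def eElementaryEmbeddingOfRexp (hMC : rexpTheory.IsModelComplete)
    {k K : Language.Theory.ModelType.{0, 0, 0} realExpTheory}
    (f : k ↪[Language.orderedExpRing] K) : k ↪ₑ[Language.orderedERing] K where
  toFun := f
  map_formula' := fun _ φ x => realize_orderedERing_comp_iff_of_rexp_isModelComplete hMC f φ x

/-- The underlying map of `eElementaryEmbeddingOfRexp hMC f` is `f`. [folklore] -/
@[simp]
theorem eElementaryEmbeddingOfRexp_apply (hMC : rexpTheory.IsModelComplete)
    {k K : Language.Theory.ModelType.{0, 0, 0} realExpTheory}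
    (f : k ↪[Language.orderedExpRing] K) (a : k) : eElementaryEmbeddingOfRexp hMC f a = f a :=
  rfl

/-- The range of an elementary embedding is an elementary substructure (general; used below for
`f(k) ≼ K | L_e`). [folklore] -/
theorem _root_.Literature.ModelTheory.ExponentialFields.isElementary_range_of_elementaryEmbedding
    {L : FirstOrder.Language} {M N : Type*} [L.Structure M] [L.Structure N] (g : M ↪ₑ[L] N) :
    g.toEmbedding.toHom.range.IsElementary := by
  intro n φ x
  let y : Fin n → M := fun i => g.toEmbedding.equivRange.symm (x i)
  have hy : (fun i => g.toEmbedding.equivRange (y i)) = x :=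
    funext fun i => Language.Equiv.apply_symm_apply g.toEmbedding.equivRange (x i)
  have hxy : ((↑) : g.toEmbedding.toHom.range → N) ∘ x = g ∘ y := by
    funext i
    rw [← hy]
    exact Embedding.equivRange_apply g.toEmbedding (y i)
  rw [hxy, g.map_formula, ← hy]
  exact (StrongHomClass.realize_formula g.toEmbedding.equivRange φ).symm

/-- **First Main Theorem ⇒ `f(k)` is (the universe of) an elementary `L_e`-substructure of
`K | L_e`** — the form `k' ≼ K'` in which den Besten's chapter 7 uses it (Remark 7.1.4,
Lemma 7.2.4: `Dcl_e` over `k' ∪ B` inside `K'`). [cite: DenBesten2016, Corollary 6.2.4] -/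
theorem isElementary_range_eEmbedding_of_rexp (hMC : rexpTheory.IsModelComplete)
    {k K : Language.Theory.ModelType.{0, 0, 0} realExpTheory}
    (f : k ↪[Language.orderedExpRing] K) : (eEmbedding f).toHom.range.IsElementary :=
  isElementary_range_of_elementaryEmbedding (eElementaryEmbeddingOfRexp hMC f)

/-- The universe of that elementary substructure is `f(k)`. [folklore] -/
theorem coe_range_eEmbedding {k K : Language.Theory.ModelType.{0, 0, w} realExpTheory}
    (f : k ↪[Language.orderedExpRing] K) :
    ((eEmbedding f).toHom.range : Set K) = Set.range f := by
  ext x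
  simp [Hom.mem_range]

end RealExpModel

end Literature.ModelTheory.ExponentialFields
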